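import Mathlib
import Summits.ResolutionOfSingularities.ResolutionOfSingularities.Theorems.HomologicalConductorPersistenceHypersurfaceJacobian
import HarnessLib

/-!
# Jacobian criterion for a monogenic extension `S[z]/(f(z))`, general relation `f`

Crux `HomologicalConductor.Persistence` (stmt-ResolutionOfSingularities-16484), chain W4.4b. `[OURS · L1 w44b]`
— the `TODO(general form)` of `Theorems/HomologicalConductorPersistenceHypersurfaceJacobian.lean`
(p485630): the relation `zⁿ + F = 0` is replaced by an ARBITRARY polynomial relation `f(z) = 0`,
`f = Σ aₖ Xᵏ ∈ S[X]` (Weierstrass / non-pure forms of hypersurface stages). NOT a statement of the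
manuscript under review; AI-drafted (weaker than expert review).

For a derivation `δ` of `S` write `f^δ(z) = Σ δ(aₖ) zᵏ ∈ B` and `f'(z) = aeval z f'`.

* `exists_liftBaseChange_comp_eq_smul_id_of_connection_aeval` — derivation homotopy, general `f`:
  `B = S[z]` (`Algebra.adjoin S {z} = ⊤`), `f(z) = 0`, `N` a `B`-module with a `δ`-connection `∇`
  ⇒ `f^δ(z) • 1_N` factors `B`-linearly through `μ : B ⊗_S N → N`. Mechanism: with `D = [∇, z]` and
  `h_k(m) = Σ_{i+j=k-1} zⁱ ⊗ D(zʲ m)` (as in p484085), `H = Σ aₖ h_k` commutes with `z`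
  (`Σ aₖ (zᵏ ⊗ Dm - 1 ⊗ D(zᵏ m)) = f(z) ⊗ Dm - 1 ⊗ D(f(z) m) = 0`) and
  `μ H = Σ aₖ [∇, zᵏ] = [∇, f(z)] - f^δ(z) = -f^δ(z)`.
* `exists_comp_eq_smul_id_aeval`, `smul_ext_eq_zero_of_derivation_aeval` — for `N` projective over
  `S`: stable factorisation through the `B`-projective `B ⊗_S N`; `f^δ(z)` kills `Ext^{≥1}_B(N, -)`.
* `sum_derivation_mem_cohomologyAnnihilatorOfDegree` — **`f^δ(z) ∈ caᵈ⁺¹(B)`** when `S` is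
  noetherian with `caᵈ⁺¹(S) = S` and `B` is module-finite projective over `S` (`d`-th `B`-syzygies are
  `S`-projective, `projective_restrictScalars_of_isSyzygy` of the sibling file).
* `aeval_derivative_mem_noetherDifferent` — **`f'(z) ∈ 𝔑(B/S)`** (Euler element
  `Σₖ aₖ Σ_{i<k} zⁱ ⊗ zᵏ⁻¹⁻ⁱ`), hence `aeval_derivative_mem_cohomologyAnnihilatorOfDegree` —
  **`f'(z) ∈ caᵈ⁺¹(B)`**.
* `span_jacobian_le_cohomologyAnnihilatorOfDegree_aeval` — `(f'(z), f^{δᵢ}(z) : i)·B ⊆ caᵈ⁺¹(B)`.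
  The concrete corollaries (`B = S[X]/(f)` with `f` monic; `S = k[x₁, …, x_d]`) are in the sibling
  file `Theorems/HomologicalConductorPersistenceMonogenicJacobianCorollaries.lean`.
-/

-- single-problem summit: the doubled namespace component is forced
set_option linter.dupNamespace false

noncomputable section

open CategoryTheory CategoryTheory.Abelian Polynomial
open scoped TensorProduct

universe u v

namespace Summit.ResolutionOfSingularities.ResolutionOfSingularities.Theorems.HomologicalConductor.PersistenceMonogenicJacobian

open Literature.RingTheory.CohomologyAnnihilator
open Summit.ResolutionOfSingularities.ResolutionOfSingularities.Theorems.HomologicalConductor.PersistenceDerivationHomotopy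
open Summit.ResolutionOfSingularities.ResolutionOfSingularities.Theorems.HomologicalConductor.PersistenceHypersurfaceJacobian

/-! ## The derivation homotopy for a general relation -/

section Homotopy

variable {S : Type u} {B : Type u} [CommRing S] [CommRing B] [Algebra S B]

/-- `aeval z f = Σ_{k ∈ supp f} aₖ • zᵏ`. [folklore] -/
theorem aeval_eq_sum_support_smul (z : B) (f : S[X]) :
    aeval z f = ∑ k ∈ f.support, f.coeff k • z ^ k := by
  rw [aeval_def, eval₂_eq_sum, sum_def]
  exact Finset.sum_congr rfl fun k _ => (Algebra.smul_def _ _).symm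

/-- **Derivation homotopy from a connection, general relation.** Let `B` be generated over `S` by
`z` with `f(z) = 0` for `f = Σ aₖ Xᵏ ∈ S[X]`, `N` a `B`-module and `∇` a `δ`-connection on `N`
(`∇ (s • m) = δ s • m + s • ∇ m`). Then `f^δ(z) • 1_N` (`f^δ(z) = Σ δ(aₖ) zᵏ`) factors
`B`-LINEARLY through the multiplication map `μ : B ⊗_S N → N`: there is a `B`-linear
`ι : N → B ⊗_S N` with `μ ∘ ι = f^δ(z) • id`. [folklore] -/
theorem exists_liftBaseChange_comp_eq_smul_id_of_connection_aeval {z : B}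
    (hz : Algebra.adjoin S {z} = ⊤) (f : S[X]) (hf : aeval z f = 0)
    {N : Type v} [AddCommGroup N] [Module B N] [Module S N] [IsScalarTower S B N]
    (δ : S → S) (nab : N →+ N) (hnab : ∀ (s : S) (m : N), nab (s • m) = δ s • m + s • nab m) :
    ∃ ι : N →ₗ[B] B ⊗[S] N,
      (LinearMap.id : N →ₗ[S] N).liftBaseChange B ∘ₗ ι =
        (∑ k ∈ f.support, δ (f.coeff k) • z ^ k) • LinearMap.id := by
  -- the multiplication map
  set μ : B ⊗[S] N →ₗ[B] N := (LinearMap.id : N →ₗ[S] N).liftBaseChange B with hμdef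
  have hμ : ∀ (b : B) (m : N), μ (b ⊗ₜ[S] m) = b • m := fun b m =>
    LinearMap.liftBaseChange_tmul B _ b m
  have hsum : ∑ k ∈ f.support, f.coeff k • z ^ k = 0 := by
    rw [← aeval_eq_sum_support_smul, hf]
  -- the `S`-linear operator `D = [∇, z]`
  have hzs : ∀ (s : S) (m : N), z • s • m = s • z • m := fun s m => smul_comm z s m
  let D : N →ₗ[S] N :=
    { toFun := fun m => nab (z • m) - z • nab m
      map_add' := fun m m' => by
        simp only [smul_add, map_add]
        abel
      map_smul' := fun s m => by
        simp only [RingHom.id_apply]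
        rw [hzs s m, hnab s (z • m), hnab s m, smul_add, hzs (δ s) m, hzs s (nab m), smul_sub]
        abel }
  have hD : ∀ m : N, D m = nab (z • m) - z • nab m := fun m => rfl
  -- the partial homotopies `h k m = Σ_{i+j=k-1} zⁱ ⊗ D (zʲ m)`
  let h : ℕ → N → B ⊗[S] N := fun k =>
    Nat.rec (motive := fun _ => N → B ⊗[S] N) (fun _ => 0)
      (fun k hk m => (1 : B) ⊗ₜ[S] D (z ^ k • m) + z • hk m) k
  have h_zero : ∀ m, h 0 m = 0 := fun m => rfl
  have h_succ : ∀ k m, h (k + 1) m = (1 : B) ⊗ₜ[S] D (z ^ k • m) + z • h k m := fun k m => rfl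
  have h_add : ∀ k (m m' : N), h k (m + m') = h k m + h k m' := by
    intro k
    induction k with
    | zero => intro m m'; simp only [h_zero, add_zero]
    | succ k ih =>
      intro m m'
      rw [h_succ, h_succ, h_succ, smul_add, map_add, TensorProduct.tmul_add, ih, smul_add]
      abel
  have h_smul : ∀ k (s : S) (m : N), h k (s • m) = s • h k m := by
    intro k
    induction k with
    | zero => intro s m; simp only [h_zero, smul_zero]
    | succ k ih =>
      intro s m
      rw [h_succ, h_succ, smul_comm (z ^ k) s m, map_smul, TensorProduct.tmul_smul, ih,
        smul_comm z s (h k m), smul_add]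
  have h_mu : ∀ k (m : N), μ (h k m) = nab (z ^ k • m) - z ^ k • nab m := by
    intro k
    induction k with
    | zero => intro m; simp only [h_zero, map_zero, pow_zero, one_smul, sub_self]
    | succ k ih =>
      intro m
      rw [h_succ, map_add, map_smul μ z (h k m), hμ, one_smul, ih, hD, smul_sub,
        smul_smul z (z ^ k) m, smul_smul z (z ^ k) (nab m), ← pow_succ']
      abel
  have h_comm : ∀ k (m : N),
      z • h k m - h k (z • m) = (z ^ k) ⊗ₜ[S] D m - (1 : B) ⊗ₜ[S] D (z ^ k • m) := by
    intro k
    induction k with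
    | zero => intro m; simp only [h_zero, smul_zero, sub_self, pow_zero, one_smul]
    | succ k ih =>
      intro m
      have ih' :
          z • h k m = h k (z • m) + ((z ^ k) ⊗ₜ[S] D m - (1 : B) ⊗ₜ[S] D (z ^ k • m)) := by
        rw [← ih m]; abel
      rw [h_succ, h_succ, smul_add, ih', smul_add, smul_sub, TensorProduct.smul_tmul',
        TensorProduct.smul_tmul', smul_eq_mul, mul_one, smul_eq_mul, ← pow_succ',
        smul_smul (z ^ k) z m, ← pow_succ]
      abel
  -- the total homotopy `H = Σ aₖ h_k`
  let H : N → B ⊗[S] N := fun m => ∑ k ∈ f.support, f.coeff k • h k m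
  have hH : ∀ m, H m = ∑ k ∈ f.support, f.coeff k • h k m := fun m => rfl
  have H_add : ∀ m m' : N, H (m + m') = H m + H m' := fun m m' => by
    simp only [hH, h_add, smul_add, Finset.sum_add_distrib]
  have H_smul : ∀ (s : S) (m : N), H (s • m) = s • H m := fun s m => by
    simp only [hH, h_smul, Finset.smul_sum]
    exact Finset.sum_congr rfl fun k _ => smul_comm _ _ _
  -- `H` commutes with `z`: the commutator telescopes to `f(z) ⊗ Dm - 1 ⊗ D(f(z) m) = 0`
  have H_z : ∀ m : N, H (z • m) = z • H m := by
    intro m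
    have e1 : z • H m - H (z • m) =
        ∑ k ∈ f.support, f.coeff k • ((z ^ k) ⊗ₜ[S] D m - (1 : B) ⊗ₜ[S] D (z ^ k • m)) := by
      rw [hH, hH, Finset.smul_sum, ← Finset.sum_sub_distrib]
      refine Finset.sum_congr rfl fun k _ => ?_
      rw [smul_comm z (f.coeff k) (h k m), ← smul_sub (f.coeff k) (z • h k m) (h k (z • m)),
        h_comm]
    have e2 : ∀ k ∈ f.support,
        f.coeff k • ((z ^ k) ⊗ₜ[S] D m - (1 : B) ⊗ₜ[S] D (z ^ k • m)) =
          (f.coeff k • z ^ k) ⊗ₜ[S] D m - (1 : B) ⊗ₜ[S] D ((f.coeff k • z ^ k) • m) := by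
      intro k _
      rw [smul_sub, TensorProduct.smul_tmul' (f.coeff k) (z ^ k) (D m),
        TensorProduct.smul_tmul' (f.coeff k) (1 : B) (D (z ^ k • m)),
        TensorProduct.smul_tmul (f.coeff k) (1 : B) (D (z ^ k • m)),
        ← map_smul D (f.coeff k) (z ^ k • m), ← smul_assoc]
    rw [Finset.sum_congr rfl e2, Finset.sum_sub_distrib, ← TensorProduct.sum_tmul,
      hsum, TensorProduct.zero_tmul, zero_sub] at e1
    have e3 : ∑ k ∈ f.support, (1 : B) ⊗ₜ[S] D ((f.coeff k • z ^ k) • m) = 0 := by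
      rw [← TensorProduct.tmul_sum, ← map_sum, ← Finset.sum_smul, hsum, zero_smul, map_zero,
        TensorProduct.tmul_zero]
    rw [e3, neg_zero, sub_eq_zero] at e1
    exact e1.symm
  -- hence `H` is `B`-linear
  have H_B : ∀ (b : B) (m : N), H (b • m) = b • H m := by
    intro b
    have hb : b ∈ Algebra.adjoin S ({z} : Set B) := by rw [hz]; exact Algebra.mem_top
    refine Algebra.adjoin_induction (p := fun b _ => ∀ m : N, H (b • m) = b • H m)
      ?_ ?_ ?_ ?_ hb
    · intro x hx m
      rw [Set.mem_singleton_iff.mp hx]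
      exact H_z m
    · intro s m
      rw [algebraMap_smul, H_smul, algebraMap_smul]
    · intro x y _ _ hx hy m
      rw [add_smul, H_add, hx, hy, add_smul]
    · intro x y _ _ hx hy m
      rw [mul_smul, hx, hy, mul_smul]
  -- `μ H = -f^δ(z)`: expand `∇ (f(z) • m) = 0`
  have H_mu : ∀ m : N, μ (H m) = -((∑ k ∈ f.support, δ (f.coeff k) • z ^ k) • m) := by
    intro m
    have e1 : μ (H m) = ∑ k ∈ f.support, f.coeff k • (nab (z ^ k • m) - z ^ k • nab m) := by
      rw [hH, map_sum]
      refine Finset.sum_congr rfl fun k _ => ?_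
      rw [LinearMap.map_smul_of_tower, h_mu]
    have e2 : ∑ k ∈ f.support, (δ (f.coeff k) • z ^ k • m + f.coeff k • nab (z ^ k • m)) = 0 := by
      have h0 : nab ((∑ k ∈ f.support, f.coeff k • z ^ k) • m) = 0 := by
        rw [hsum, zero_smul, map_zero]
      rw [Finset.sum_smul, map_sum] at h0
      rw [← h0]
      refine Finset.sum_congr rfl fun k _ => ?_
      rw [smul_assoc, hnab]
    have e3 : ∑ k ∈ f.support, f.coeff k • z ^ k • nab m = 0 := by
      have h0 : (∑ k ∈ f.support, f.coeff k • z ^ k) • nab m = 0 := by rw [hsum, zero_smul]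
      rw [Finset.sum_smul] at h0
      rw [← h0]
      exact Finset.sum_congr rfl fun k _ => (smul_assoc _ _ _).symm
    have e4 : ∑ k ∈ f.support, f.coeff k • nab (z ^ k • m) =
        -∑ k ∈ f.support, δ (f.coeff k) • z ^ k • m := by
      rw [eq_neg_iff_add_eq_zero, add_comm, ← Finset.sum_add_distrib]
      exact e2
    rw [e1]
    simp only [smul_sub, Finset.sum_sub_distrib, e3, sub_zero, e4, Finset.sum_smul, smul_assoc]
  let ιB : N →ₗ[B] B ⊗[S] N :=
    { toFun := H
      map_add' := H_add
      map_smul' := fun b m => H_B b m }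
  refine ⟨-ιB, LinearMap.ext fun m => ?_⟩
  change μ (-(H m)) = (∑ k ∈ f.support, δ (f.coeff k) • z ^ k) • m
  rw [map_neg, H_mu, neg_neg]

/-- **Derivation homotopy, general relation (stable factorisation form).** With `B = S[z]`, `f(z) = 0`,
for every derivation `δ` of `S` and every `B`-module `N` PROJECTIVE over `S`, `f^δ(z) • 1_N` factors
`B`-linearly through the `B`-projective module `B ⊗_S N`. [folklore] -/
theorem exists_comp_eq_smul_id_aeval {R : Type*} [CommRing R] [Algebra R S] (δ : Derivation R S S)
    {z : B} (hz : Algebra.adjoin S {z} = ⊤) (f : S[X]) (hf : aeval z f = 0)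
    (N : Type v) [AddCommGroup N] [Module B N] [Module S N] [IsScalarTower S B N]
    [Module.Projective S N] :
    ∃ (ι : N →ₗ[B] B ⊗[S] N) (π : B ⊗[S] N →ₗ[B] N),
      π ∘ₗ ι = (∑ k ∈ f.support, δ (f.coeff k) • z ^ k) • LinearMap.id := by
  obtain ⟨nab, hnab⟩ := exists_connection δ N
  obtain ⟨ι, hι⟩ :=
    exists_liftBaseChange_comp_eq_smul_id_of_connection_aeval hz f hf (δ : S → S) nab hnab
  exact ⟨ι, _, hι⟩

/-- **`f^δ(z)` kills `Ext^{≥ 1}` of `S`-projective `B`-modules** (general relation; exponent one,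
characteristic-free). [folklore] -/
theorem smul_ext_eq_zero_of_derivation_aeval {R : Type*} [CommRing R] [Algebra R S]
    (δ : Derivation R S S) {z : B} (hz : Algebra.adjoin S {z} = ⊤) (f : S[X]) (hf : aeval z f = 0)
    (N : Type u) [AddCommGroup N] [Module B N] [Module S N] [IsScalarTower S B N]
    [Module.Projective S N] (M : ModuleCat.{u} B) {i : ℕ} (hi : 1 ≤ i)
    (e : Ext.{u} (ModuleCat.of B N) M i) : (∑ k ∈ f.support, δ (f.coeff k) • z ^ k) • e = 0 := by
  obtain ⟨ι, π, h⟩ := exists_comp_eq_smul_id_aeval δ hz f hf N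
  exact smul_ext_eq_zero_of_linearMap_comp_eq_smul_id ι π h M hi e

end Homotopy

/-! ## Memberships in `caᵈ⁺¹` -/

section Jacobian

variable {S : Type u} [CommRing S] {B : Type u} [CommRing B] [Algebra S B]

/-- **`f^δ(z) ∈ caᵈ⁺¹(S[z]/(f))`**: `S` noetherian with `caᵈ⁺¹(S) = S`, `B = S[z]` module-finite and
projective over `S` with `f(z) = 0`, `δ` a derivation of `S`. (`d`-th `B`-syzygies are
`S`-projective, `projective_restrictScalars_of_isSyzygy`; `f^δ(z)` stably annihilates them; dimension
shifting.) [folklore] -/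
theorem sum_derivation_mem_cohomologyAnnihilatorOfDegree [IsNoetherianRing S] [Module.Finite S B]
    [Module.Projective S B] {d : ℕ} (hvan : cohomologyAnnihilatorOfDegree S (d + 1) = ⊤)
    {R : Type*} [CommRing R] [Algebra R S] (δ : Derivation R S S) {z : B}
    (hz : Algebra.adjoin S {z} = ⊤) (f : S[X]) (hf : aeval z f = 0) :
    (∑ k ∈ f.support, δ (f.coeff k) • z ^ k) ∈ cohomologyAnnihilatorOfDegree B (d + 1) := by
  haveI : IsNoetherianRing B := isNoetherian_of_tower S inferInstance
  rw [mem_cohomologyAnnihilatorOfDegree_iff_of_isNoetherianRing]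
  intro M N hM hN e
  haveI := hM
  obtain ⟨K, _, hK⟩ := exists_isSyzygy M d
  have hKproj : Projective ((restrictScalarsFunctor S B).obj K) :=
    projective_restrictScalars_of_isSyzygy hvan hK
  letI : Module S K := Module.compHom K (algebraMap S B)
  haveI : IsScalarTower S B K := IsScalarTower.of_algebraMap_smul fun _ _ => rfl
  haveI : Module.Projective S K :=
    (IsProjective.iff_projective (R := S) ((restrictScalarsFunctor S B).obj K)).mpr hKproj
  have h1 : ∀ N' : ModuleCat.{u} B, Module.Finite B N' →
      ∀ e' : Ext.{u} K N' 1, (∑ k ∈ f.support, δ (f.coeff k) • z ^ k) • e' = 0 := fun N' _ e' =>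
    smul_ext_eq_zero_of_derivation_aeval δ hz f hf K N' le_rfl e'
  have := ext_smul_eq_zero_of_isSyzygy_of_forall d hK h1 N hN
  rw [add_comm] at this
  exact this e

/-- **`f'(z) ∈ 𝔑(B/S)` for `B = S[z]`, `f(z) = 0`** (the Euler element
`t = Σₖ aₖ Σ_{i<k} zⁱ ⊗ zᵏ⁻¹⁻ⁱ ∈ B ⊗_S B` centralises the two `B`-structures — its commutator with
`z` telescopes to `Σ aₖ (zᵏ ⊗ 1 - 1 ⊗ zᵏ) = f(z) ⊗ 1 - 1 ⊗ f(z) = 0` — and multiplies to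
`Σ k aₖ zᵏ⁻¹ = f'(z)`). [folklore] -/
theorem aeval_derivative_mem_noetherDifferent {z : B} (hz : Algebra.adjoin S {z} = ⊤) (f : S[X])
    (hf : aeval z f = 0) : aeval z (derivative f) ∈ noetherDifferent S B := by
  have hsum : ∑ k ∈ f.support, f.coeff k • z ^ k = 0 := by
    rw [← aeval_eq_sum_support_smul, hf]
  rw [mem_noetherDifferent_iff]
  let t : ℕ → B ⊗[S] B := fun n => ∑ i ∈ Finset.range n, (z ^ i) ⊗ₜ[S] (z ^ (n - 1 - i))
  have ht : ∀ n, t n = ∑ i ∈ Finset.range n, (z ^ i) ⊗ₜ[S] (z ^ (n - 1 - i)) := fun n => rfl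
  -- commutator of `t n` with `z`
  have hcomm : ∀ n : ℕ,
      (z ⊗ₜ[S] (1 : B)) * t n - ((1 : B) ⊗ₜ[S] z) * t n = (z ^ n) ⊗ₜ[S] 1 - (1 : B) ⊗ₜ[S] (z ^ n) := by
    intro n
    rw [ht, Finset.mul_sum, Finset.mul_sum, ← Finset.sum_sub_distrib]
    have hterm : ∀ i ∈ Finset.range n,
        (z ⊗ₜ[S] (1 : B)) * ((z ^ i) ⊗ₜ[S] (z ^ (n - 1 - i))) -
          ((1 : B) ⊗ₜ[S] z) * ((z ^ i) ⊗ₜ[S] (z ^ (n - 1 - i))) =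
        (z ^ (i + 1)) ⊗ₜ[S] (z ^ (n - (i + 1))) - (z ^ i) ⊗ₜ[S] (z ^ (n - i)) := by
      intro i hi
      have hi' : i < n := Finset.mem_range.mp hi
      rw [Algebra.TensorProduct.tmul_mul_tmul, Algebra.TensorProduct.tmul_mul_tmul, one_mul,
        one_mul, ← pow_succ', ← pow_succ', show n - 1 - i + 1 = n - i by omega,
        show n - 1 - i = n - (i + 1) by omega]
    rw [Finset.sum_congr rfl hterm,
      Finset.sum_range_sub (fun i => (z ^ i) ⊗ₜ[S] (z ^ (n - i))), Nat.sub_self, pow_zero,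
      Nat.sub_zero]
  -- multiplication of `t n`
  have hmul : ∀ n : ℕ,
      Algebra.TensorProduct.lmul' (S := B) S (t n) = (n : B) * z ^ (n - 1) := by
    intro n
    rw [ht, map_sum]
    have hterm : ∀ i ∈ Finset.range n,
        Algebra.TensorProduct.lmul' (S := B) S ((z ^ i) ⊗ₜ[S] (z ^ (n - 1 - i))) = z ^ (n - 1) := by
      intro i hi
      have hi' : i < n := Finset.mem_range.mp hi
      rw [Algebra.TensorProduct.lmul'_apply_tmul, ← pow_add, show i + (n - 1 - i) = n - 1 by omega]
    rw [Finset.sum_congr rfl hterm, Finset.sum_const, Finset.card_range, nsmul_eq_mul]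
  refine ⟨∑ k ∈ f.support, f.coeff k • t k, ?_, ?_⟩
  · intro b
    have hb : b ∈ Algebra.adjoin S ({z} : Set B) := by rw [hz]; exact Algebra.mem_top
    refine Algebra.adjoin_induction (p := fun b _ =>
      (b ⊗ₜ[S] (1 : B)) * (∑ k ∈ f.support, f.coeff k • t k) =
        ((1 : B) ⊗ₜ[S] b) * ∑ k ∈ f.support, f.coeff k • t k) ?_ ?_ ?_ ?_ hb
    · intro x hx
      rw [Set.mem_singleton_iff.mp hx, ← sub_eq_zero, Finset.mul_sum, Finset.mul_sum,
        ← Finset.sum_sub_distrib]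
      have hterm : ∀ k ∈ f.support,
          (z ⊗ₜ[S] (1 : B)) * (f.coeff k • t k) - ((1 : B) ⊗ₜ[S] z) * (f.coeff k • t k) =
            (f.coeff k • z ^ k) ⊗ₜ[S] (1 : B) - (1 : B) ⊗ₜ[S] (f.coeff k • z ^ k) := by
        intro k _
        rw [mul_smul_comm, mul_smul_comm, ← smul_sub, hcomm, smul_sub, TensorProduct.smul_tmul',
          TensorProduct.tmul_smul]
      rw [Finset.sum_congr rfl hterm, Finset.sum_sub_distrib, ← TensorProduct.sum_tmul,
        ← TensorProduct.tmul_sum, hsum, TensorProduct.zero_tmul, TensorProduct.tmul_zero, sub_self]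
    · intro s
      rw [Algebra.algebraMap_eq_smul_one, TensorProduct.smul_tmul]
    · intro x y _ _ hx hy
      rw [TensorProduct.add_tmul, TensorProduct.tmul_add, add_mul, add_mul, hx, hy]
    · intro x y _ _ hx hy
      have ex : (x * y) ⊗ₜ[S] (1 : B) = (x ⊗ₜ[S] (1 : B)) * (y ⊗ₜ[S] (1 : B)) := by
        rw [Algebra.TensorProduct.tmul_mul_tmul, mul_one]
      have ey : (1 : B) ⊗ₜ[S] (x * y) = ((1 : B) ⊗ₜ[S] y) * ((1 : B) ⊗ₜ[S] x) := by
        rw [Algebra.TensorProduct.tmul_mul_tmul, mul_one, mul_comm y x]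
      rw [ex, ey, mul_assoc, hy, ← mul_assoc, mul_comm (x ⊗ₜ[S] (1 : B)), mul_assoc, hx,
        ← mul_assoc]
  · rw [map_sum]
    have hterm : ∀ k ∈ f.support,
        Algebra.TensorProduct.lmul' (S := B) S (f.coeff k • t k) =
          algebraMap S B (f.coeff k * k) * z ^ (k - 1) := by
      intro k _
      rw [map_smul (Algebra.TensorProduct.lmul' (S := B) S) (f.coeff k) (t k), hmul,
        Algebra.smul_def, map_mul, map_natCast, mul_assoc]
    rw [Finset.sum_congr rfl hterm, derivative_apply, sum_def, map_sum]
    refine Finset.sum_congr rfl fun k _ => ?_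
    rw [map_mul (aeval z), aeval_C, map_pow (aeval z), aeval_X]

/-- **`f'(z) ∈ caᵈ⁺¹(S[z]/(f))`**: `S` noetherian with `caᵈ⁺¹(S) = S`, `B = S[z]` module-finite and
projective over `S`, `f(z) = 0` — the noether-different half (`aeval_derivative_mem_noetherDifferent`
+ Iyengar–Takahashi Prop. 3.4 with `I' = S`). [folklore] -/
theorem aeval_derivative_mem_cohomologyAnnihilatorOfDegree [IsNoetherianRing S] [Module.Finite S B]
    [Module.Projective S B] {d : ℕ} (hvan : cohomologyAnnihilatorOfDegree S (d + 1) = ⊤) {z : B}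
    (hz : Algebra.adjoin S {z} = ⊤) (f : S[X]) (hf : aeval z f = 0) :
    aeval z (derivative f) ∈ cohomologyAnnihilatorOfDegree B (d + 1) := by
  have h1 : (1 : S) ∈
      extAnnihilatorFrom ((restrictScalarsFunctor S B).obj (ModuleCat.of B B)) 1 ^ d := by
    rw [extAnnihilatorFrom_restrictScalars_eq_top, Ideal.top_pow]
    exact Submodule.mem_top
  have h := noetherDifferent_mul_mem_cohomologyAnnihilatorOfDegree hvan
    (aeval_derivative_mem_noetherDifferent hz f hf) h1
  rwa [map_one, mul_one] at h

/-- **Jacobian criterion, monogenic form, general relation.** `S` noetherian, `caᵈ⁺¹(S) = S`,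
`B = S[z]` module-finite projective over `S`, `f(z) = 0`, `δᵢ` any family of derivations of `S`:
the ideal `(f'(z), f^{δᵢ}(z) : i)·B` lies in `caᵈ⁺¹(B)`. [folklore] -/
theorem span_jacobian_le_cohomologyAnnihilatorOfDegree_aeval [IsNoetherianRing S]
    [Module.Finite S B] [Module.Projective S B] {d : ℕ}
    (hvan : cohomologyAnnihilatorOfDegree S (d + 1) = ⊤) {R : Type*} [CommRing R] [Algebra R S]
    {ι : Type*} (δ : ι → Derivation R S S) {z : B} (hz : Algebra.adjoin S {z} = ⊤) (f : S[X])
    (hf : aeval z f = 0) :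
    Ideal.span (insert (aeval z (derivative f))
        (Set.range fun i => ∑ k ∈ f.support, δ i (f.coeff k) • z ^ k)) ≤
      cohomologyAnnihilatorOfDegree B (d + 1) := by
  rw [Ideal.span_le]
  rintro x (rfl | ⟨i, rfl⟩)
  · exact aeval_derivative_mem_cohomologyAnnihilatorOfDegree hvan hz f hf
  · exact sum_derivation_mem_cohomologyAnnihilatorOfDegree hvan (δ i) hz f hf

end Jacobian


end Summit.ResolutionOfSingularities.ResolutionOfSingularities.Theorems.HomologicalConductor.PersistenceMonogenicJacobian

end
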